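import Literature.NumberTheory.Automorphic.RealMatrixGroups
import Mathlib.Analysis.Complex.Polynomial.Basic
import Mathlib.LinearAlgebra.Lagrange
import Mathlib.LinearAlgebra.Trace
import Mathlib.RingTheory.Trace.Basic
import HarnessLib

/-!
# The trace of a star-formally-real algebra is positive

Let `A` be a finite-dimensional commutative real Banach `*`-algebra with `ℝ`-linear involution
which is star-formally real (`IsStarFormallyReal A` of `RealMatrixGroups`: `∑ star xᵢ · xᵢ = 0`
forces `xᵢ = 0`; the standing hypothesis on the coefficient algebra of a regular automorphy
datum, `AutomorphyDatum.IsRegular.isStarFormallyReal`). This file PROVES that the regular trace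
`tr = Algebra.trace ℝ A` is a faithful positive `*`-trace:

* `trace_star` — `tr (star x) = tr x`;
* `IsStarFormallyReal.trace_mul_star_self_pos` — **`tr (a · star a) > 0` for `a ≠ 0`**, with
  `trace_mul_star_self_nonneg`, `trace_sum_mul_star_self_pos`.

Consequently the trace form `(X, Y) ↦ tr (Tr (X Y))` of `𝔤𝔩(N, A)` is positive definite on
hermitian and negative definite on skew-hermitian matrices — the Cartan decomposition of the
trace form needed for the Casimir element of the Lie algebra of a regular automorphy datum
(sequel `CasimirRegularDatum`).

Proof (no structure theory of `A` is used): scalar formal-reality lemmas (no nilpotent and no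
non-real "eigenvalues" for self-adjoint elements, no negative ones for `a · star a`:
`mul_eq_zero_of_sa`, `eq_zero_of_quadratic_sa`, `eq_zero_of_neg_eigen`, the scalar forms of the
eigen-matrix lemmas of `RealMatrixGroupsProofs`); peeling the complex roots of an annihilating
polynomial of `b = a · star a` (fundamental theorem of algebra) leaves `∏_{r ∈ s} (b - r) = 0`
for finitely many reals `r ≥ 0` (`exists_list_prod_mul_eq_zero`, `exists_finset_prod_eq_zero`);
the Lagrange idempotents `e_r = ℓ_r(b)` then give `b = ∑ r e_r` and
`tr b = ∑ r · dim (e_r A) > 0` (`LinearMap.IsProj.trace`).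

## References

* A. W. Knapp, *Lie Groups Beyond an Introduction*, 2nd ed. (2002), I.§1 and VI.§2 (the trace
  form `Re Tr (X Y)` on `𝔤𝔩(n, ℝ)`, `𝔤𝔩(n, ℂ)` and its Cartan decomposition) [Knapp2002].
* A. Borel, H. Jacquet, *Automorphic forms and automorphic representations*, Proc. Sympos. Pure
  Math. 33.1 (1979), §1.1 (the archimedean groups) [BorelJacquetCorvallis1979].
-/

noncomputable section

open Polynomial Finset

namespace Literature.NumberTheory.Automorphic

variable {A : Type*} [NormedCommRing A] [StarRing A] [NormedAlgebra ℝ A] [StarModule ℝ A]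

/-! ## 1. Formal reality at scalar level -/

omit [NormedAlgebra ℝ A] [StarModule ℝ A] in
/-- No nilpotency for self-adjoint elements of a star-formally-real algebra:
`h (h m) = 0 → h m = 0`. Knapp 2002, I.§1. [folklore] -/
theorem IsStarFormallyReal.mul_eq_zero_of_sa (hA : IsStarFormallyReal A) {h m : A}
    (hh : star h = h) (H : h * (h * m) = 0) : h * m = 0 := by
  have key : star (h * m) * (h * m) = 0 := by
    rw [star_mul', hh]
    calc h * star m * (h * m) = star m * (h * (h * m)) := by ring
      _ = 0 := by rw [H, mul_zero]
  exact hA 1 (fun _ ↦ h * m) (by rw [Fin.sum_univ_one]; exact key) 0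

omit [NormedAlgebra ℝ A] [StarModule ℝ A] in
/-- Iterated: `h^{k+1} m = 0` forces `h m = 0` for self-adjoint `h`. [folklore] -/
theorem IsStarFormallyReal.mul_eq_zero_of_pow_succ_mul_eq_zero (hA : IsStarFormallyReal A) {h : A}
    (hh : star h = h) : ∀ (k : ℕ) (m : A), h ^ (k + 1) * m = 0 → h * m = 0 := by
  intro k
  induction k with
  | zero => intro m H; simpa using H
  | succ k ih =>
    intro m H
    have H' : h ^ (k + 1) * (h * m) = 0 := by
      calc h ^ (k + 1) * (h * m) = h ^ (k + 1 + 1) * m := by ring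
        _ = 0 := H
    exact hA.mul_eq_zero_of_sa hh (ih (h * m) H')

/-- No non-real eigenvalues for self-adjoint elements: `((h - α)² + β²) m = 0`, `β ≠ 0`, forces
`m = 0`. Knapp 2002, I.§1. [folklore] -/
theorem IsStarFormallyReal.eq_zero_of_quadratic_sa (hA : IsStarFormallyReal A) {h m : A}
    (hh : star h = h) (α β : ℝ) (hβ : β ≠ 0)
    (H : ((h - algebraMap ℝ A α) ^ 2 + algebraMap ℝ A (β ^ 2)) * m = 0) : m = 0 := by
  set Y : A := h - algebraMap ℝ A α with hY
  have hYs : star Y = Y := by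
    rw [hY, star_sub, hh, ← algebraMap_star_comm, star_trivial]
  have h' : Y * (Y * m) + (β ^ 2) • m = 0 := by
    rwa [add_mul, pow_two, mul_assoc, Algebra.algebraMap_eq_smul_one, smul_mul_assoc, one_mul] at H
  have e1 : star (Y * m) * (Y * m) = star m * (Y * (Y * m)) := by rw [star_mul', hYs]; ring
  have e2 : star (β • m) * (β • m) = star m * ((β ^ 2) • m) := by
    have : star (β • m) = β • star m := by rw [star_smul, star_trivial]
    rw [this, smul_mul_smul_comm, mul_smul_comm, pow_two]
  have key : ∑ i : Fin 2, star (![Y * m, β • m] i) * ![Y * m, β • m] i = 0 := by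
    rw [Fin.sum_univ_two]
    simp only [Matrix.cons_val_zero, Matrix.cons_val_one]
    rw [e1, e2, ← mul_add, h', mul_zero]
  have := hA 2 _ key 1
  simp only [Matrix.cons_val_one, Matrix.cons_val_zero] at this
  exact (smul_eq_zero.mp this).resolve_left hβ

/-- No negative eigenvalues for `a · star a`: `(a · star a) m = -γ² m`, `γ ≠ 0`, forces `m = 0`.
[folklore] -/
theorem IsStarFormallyReal.eq_zero_of_neg_eigen (hA : IsStarFormallyReal A) {a m : A} (γ : ℝ)
    (hγ : γ ≠ 0) (H : a * star a * m = -(algebraMap ℝ A (γ ^ 2)) * m) : m = 0 := by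
  have h' : a * star a * m + (γ ^ 2) • m = 0 := by
    rw [H, Algebra.algebraMap_eq_smul_one, neg_mul, smul_mul_assoc, one_mul, neg_add_cancel]
  have e1 : star (star a * m) * (star a * m) = star m * (a * star a * m) := by
    rw [star_mul', star_star]; ring
  have e2 : star (γ • m) * (γ • m) = star m * ((γ ^ 2) • m) := by
    have : star (γ • m) = γ • star m := by rw [star_smul, star_trivial]
    rw [this, smul_mul_smul_comm, mul_smul_comm, pow_two]
  have key : ∑ i : Fin 2, star (![star a * m, γ • m] i) * ![star a * m, γ • m] i = 0 := by
    rw [Fin.sum_univ_two]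
    simp only [Matrix.cons_val_zero, Matrix.cons_val_one]
    rw [e1, e2, ← mul_add, h', mul_zero]
  have := hA 2 _ key 1
  simp only [Matrix.cons_val_one, Matrix.cons_val_zero] at this
  exact (smul_eq_zero.mp this).resolve_left hγ

/-! ## 2. An annihilating product of real factors `b - r`, `r ≥ 0`, for `b = a · star a` -/

/-- **Peeling the roots of an annihilating polynomial of `b = a · star a`.** If `g ≠ 0` and
`g(b) m = 0` then `∏_{r ∈ l} (b - r) · m = 0` for a list `l` of NONNEGATIVE reals: split off a
complex root `z` of `g` (fundamental theorem of algebra); a non-real root gives a real quadratic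
factor, which cannot kill anything (`eq_zero_of_quadratic_sa`); a negative real root cannot either
(`eq_zero_of_neg_eigen`); a nonnegative real root is recorded. (The argument of
`IsStarFormallyReal.mul_eq_zero_of_aeval_mul_eq_zero` of `RealMatrixGroupsProofs`, at scalar level.)
[folklore] -/
theorem IsStarFormallyReal.exists_list_prod_mul_eq_zero (hA : IsStarFormallyReal A) (a : A) :
    ∀ (g : ℝ[X]), g ≠ 0 → ∀ m : A, aeval (a * star a) g * m = 0 →
      ∃ l : List ℝ, (∀ r ∈ l, 0 ≤ r) ∧
        (l.map fun r ↦ a * star a - algebraMap ℝ A r).prod * m = 0 := by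
  set b : A := a * star a with hb
  have hbs : star b = b := by rw [hb, star_mul', star_star, mul_comm]
  suffices key : ∀ (n : ℕ) (g : ℝ[X]), g.natDegree = n → g ≠ 0 → ∀ m : A, aeval b g * m = 0 →
      ∃ l : List ℝ, (∀ r ∈ l, 0 ≤ r) ∧ (l.map fun r ↦ b - algebraMap ℝ A r).prod * m = 0 from
    fun g hg m hm ↦ key _ g rfl hg m hm
  intro n
  induction n using Nat.strong_induction_on with
  | _ n ih =>
    intro g hdeg hg m hm
    by_cases hn : n = 0
    · subst hn
      have hgC : g = C (g.coeff 0) := eq_C_of_natDegree_eq_zero hdeg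
      have hc : g.coeff 0 ≠ 0 := fun h0 ↦ hg (by rw [hgC, h0, map_zero])
      rw [hgC, aeval_C, Algebra.algebraMap_eq_smul_one, smul_mul_assoc, one_mul] at hm
      refine ⟨[], by simp, ?_⟩
      simpa using (smul_eq_zero.mp hm).resolve_left hc
    · have hdeg' : g.degree ≠ 0 := (natDegree_pos_iff_degree_pos.mp (by omega)).ne'
      obtain ⟨z, hz⟩ := IsAlgClosed.exists_aeval_eq_zero ℂ g hdeg'
      by_cases him : z.im = 0
      · -- real root
        have hroot : g.IsRoot z.re := by
          have hzr : z = algebraMap ℝ ℂ z.re := by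
            rw [Complex.coe_algebraMap]; exact Complex.ext (by simp) (by simp [him])
          rw [hzr, aeval_algebraMap_apply_eq_algebraMap_eval, map_eq_zero_iff _ (algebraMap ℝ ℂ).injective] at hz
          exact hz
        set g₁ := g /ₘ (X - C z.re)
        have hfg : g = (X - C z.re) * g₁ := (mul_divByMonic_eq_iff_isRoot.mpr hroot).symm
        have hg0 : g₁ ≠ 0 := fun h0 ↦ hg (by rw [hfg, h0, mul_zero])
        have hgdeg : g₁.natDegree < n := by
          have := congrArg natDegree hfg
          rw [natDegree_mul (X_sub_C_ne_zero z.re) hg0, natDegree_X_sub_C] at this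
          omega
        -- `(b - r) (g₁(b) m) = 0`, i.e. `g₁(b) ((b - r) m) = 0`
        have hM' : aeval b g₁ * ((b - algebraMap ℝ A z.re) * m) = 0 := by
          rw [hfg, map_mul, map_sub, aeval_X, aeval_C] at hm
          calc aeval b g₁ * ((b - algebraMap ℝ A z.re) * m) = (b - algebraMap ℝ A z.re) * aeval b g₁ * m := by ring
            _ = 0 := hm
        by_cases hr : 0 ≤ z.re
        · obtain ⟨l, hl, hprod⟩ := ih _ hgdeg g₁ rfl hg0 _ hM'
          refine ⟨z.re :: l, ?_, ?_⟩
          · intro r hr'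
            rcases List.mem_cons.mp hr' with rfl | h
            · exact hr
            · exact hl r h
          · rw [List.map_cons, List.prod_cons]
            calc (b - algebraMap ℝ A z.re) * (l.map fun r ↦ b - algebraMap ℝ A r).prod * m =
                (l.map fun r ↦ b - algebraMap ℝ A r).prod * ((b - algebraMap ℝ A z.re) * m) := by ring
              _ = 0 := hprod
        · -- negative root: `b (g₁(b) m) = r (g₁(b) m)` with `r = -γ²`
          have hneg : z.re < 0 := lt_of_not_ge hr
          set γ : ℝ := Real.sqrt (-z.re) with hγ
          have hγ0 : γ ≠ 0 := (Real.sqrt_pos.2 (by linarith)).ne'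
          have hγ2 : γ ^ 2 = -z.re := Real.sq_sqrt (by linarith)
          have hM'' : b * (aeval b g₁ * m) = -(algebraMap ℝ A (γ ^ 2)) * (aeval b g₁ * m) := by
            have h1 : (b - algebraMap ℝ A z.re) * (aeval b g₁ * m) = 0 := by
              rw [hfg, map_mul, map_sub, aeval_X, aeval_C] at hm
              calc (b - algebraMap ℝ A z.re) * (aeval b g₁ * m) = (b - algebraMap ℝ A z.re) * aeval b g₁ * m := by ring
                _ = 0 := hm
            rw [hγ2, map_neg, neg_neg]
            rw [sub_mul, sub_eq_zero] at h1
            exact h1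
          have hzero : aeval b g₁ * m = 0 := hA.eq_zero_of_neg_eigen γ hγ0 (by rw [← hb]; exact hM'')
          exact ih _ hgdeg g₁ rfl hg0 m hzero
      · -- non-real root: `(X - re z)² + (im z)²` divides `g`
        obtain ⟨g₁, hfg⟩ := g.quadratic_dvd_of_aeval_eq_zero_im_ne_zero hz him
        have hq : (X ^ 2 - C (2 * z.re) * X + C (‖z‖ ^ 2) : ℝ[X]) = (X - C z.re) ^ 2 + C (z.im ^ 2) := by
          rw [Complex.sq_norm, Complex.normSq_apply]
          simp only [map_mul, map_add, map_pow, map_ofNat]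
          ring
        have h2 : natDegree (X ^ 2 - C (2 * z.re) * X + C (‖z‖ ^ 2) : ℝ[X]) = 2 := by
          compute_degree!
        have hq0 : (X ^ 2 - C (2 * z.re) * X + C (‖z‖ ^ 2) : ℝ[X]) ≠ 0 :=
          ne_zero_of_natDegree_gt (n := 1) (by rw [h2]; exact one_lt_two)
        have hg0 : g₁ ≠ 0 := fun h0 ↦ hg (by rw [hfg, h0, mul_zero])
        have hgdeg : g₁.natDegree < n := by
          have := congrArg natDegree hfg
          rw [natDegree_mul hq0 hg0, h2] at this
          omega
        have hM' : aeval b g₁ * m = 0 := by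
          rw [hfg, hq, map_mul, mul_assoc, map_add, map_pow, map_sub, aeval_X, aeval_C, aeval_C] at hm
          exact hA.eq_zero_of_quadratic_sa hbs z.re z.im him hm
        exact ih _ hgdeg g₁ rfl hg0 m hM'

/-- **An annihilating product of distinct nonnegative real factors for `b = a · star a`** (finite
dimensional `A`): there is a finite set `s` of nonnegative reals with `∏_{r ∈ s} (b - r) = 0`.
[folklore] -/
theorem IsStarFormallyReal.exists_finset_prod_eq_zero [FiniteDimensional ℝ A] (hA : IsStarFormallyReal A)
    (a : A) : ∃ s : Finset ℝ, (∀ r ∈ s, 0 ≤ r) ∧ ∏ r ∈ s, (a * star a - algebraMap ℝ A r) = 0 := by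
  classical
  set b : A := a * star a with hb
  have hbs : star b = b := by rw [hb, star_mul', star_star, mul_comm]
  obtain ⟨f, hfm, hf⟩ := Algebra.IsIntegral.isIntegral (R := ℝ) b
  rw [← aeval_def] at hf
  obtain ⟨l, hl, hprod⟩ := hA.exists_list_prod_mul_eq_zero a f hfm.ne_zero 1 (by rw [← hb, hf, zero_mul])
  rw [mul_one] at hprod
  refine ⟨l.toFinset, fun r hr ↦ hl r (List.mem_toFinset.mp hr), ?_⟩
  set P : A := ∏ r ∈ l.toFinset, (b - algebraMap ℝ A r) with hP
  -- `∏_{r ∈ l} (b - r)` divides `P ^ |l|`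
  have hdvd : ∀ l' : List ℝ, (∀ r ∈ l', r ∈ l.toFinset) →
      (l'.map fun r ↦ b - algebraMap ℝ A r).prod ∣ P ^ l'.length := by
    intro l'
    induction l' with
    | nil => intro; simp
    | cons r l' ih' =>
      intro hmem
      rw [List.map_cons, List.prod_cons, List.length_cons, pow_succ']
      refine mul_dvd_mul ?_ (ih' fun r' hr' ↦ hmem r' (List.mem_cons_of_mem _ hr'))
      exact Finset.dvd_prod_of_mem _ (hmem r List.mem_cons_self)
  have hPl : P ^ l.length = 0 := by
    obtain ⟨q, hq⟩ := hdvd l fun r hr ↦ List.mem_toFinset.mpr hr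
    rw [hq, hprod, zero_mul]
  -- `P` is self-adjoint, so `P = 0`
  have hPs : star P = P := by
    rw [hP, star_prod]
    refine Finset.prod_congr rfl fun r _ ↦ ?_
    rw [star_sub, hbs, Algebra.algebraMap_eq_smul_one, star_smul, star_one, star_trivial]
  rcases Nat.eq_zero_or_pos l.length with h0 | hpos
  · -- `l = []`: then `1 = 0` in `A`, everything vanishes
    rw [h0, pow_zero] at hPl
    calc P = 1 * P := (one_mul P).symm
      _ = 0 := by rw [hPl, zero_mul]
  · obtain ⟨k, hk⟩ := Nat.exists_eq_succ_of_ne_zero hpos.ne'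
    have h1 : P ^ (k + 1) * 1 = 0 := by rw [mul_one, ← Nat.succ_eq_add_one, ← hk, hPl]
    have := hA.mul_eq_zero_of_pow_succ_mul_eq_zero hPs k 1 h1
    rwa [mul_one] at this


/-! ## 3. The trace is star-invariant and positive -/

section Trace

variable [FiniteDimensional ℝ A]

omit [StarRing A] [StarModule ℝ A] [FiniteDimensional ℝ A] in
/-- `lmul x y = x y`. [folklore] -/
theorem lmul_apply' (x y : A) : Algebra.lmul ℝ A x y = x * y := rfl

omit [FiniteDimensional ℝ A] in
/-- **The trace is star-invariant**: `tr (star x) = tr x` (star is an `ℝ`-linear automorphism of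
`A` conjugating `L_x` into `L_{star x}`). [folklore] -/
theorem trace_star (x : A) : Algebra.trace ℝ A (star x) = Algebra.trace ℝ A x := by
  let σ : A ≃ₗ[ℝ] A :=
    { toFun := star
      invFun := star
      map_add' := star_add
      map_smul' := fun r y ↦ by rw [star_smul, star_trivial]; rfl
      left_inv := star_star
      right_inv := star_star }
  have hconj : (Algebra.lmul ℝ A (star x) : A →ₗ[ℝ] A) = σ.conj (Algebra.lmul ℝ A x) := by
    ext y
    rw [LinearEquiv.conj_apply_apply, lmul_apply', lmul_apply']
    change star x * y = star (x * star y)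
    rw [star_mul', star_star]
  rw [Algebra.trace_apply, Algebra.trace_apply, hconj, LinearMap.trace_conj']

/-- **Positivity of the trace on a star-formally-real algebra**: `tr (a · star a) > 0` for
`a ≠ 0` (finite-dimensional commutative real `*`-algebra with `ℝ`-linear involution).
Proof: `b = a · star a` is annihilated by `∏_{r ∈ s} (b - r)` for a finite set `s` of
NONNEGATIVE reals (`exists_finset_prod_eq_zero`); the Lagrange idempotents `e_r = ℓ_r(b)` give
`∑ e_r = 1`, `e_r e_{r'} = 0`, `b = ∑ r e_r`, so `tr b = ∑_r r · dim (e_r A) ≥ 0`, and `> 0`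
since `b ≠ 0` forces some `r e_r ≠ 0`. This is the positivity that makes the trace form
`(X, Y) ↦ tr (Tr (X Y))` of `𝔤𝔩(N, A)` definite on hermitian and skew-hermitian matrices (the
Cartan decomposition of the trace form, Knapp 2002, VI.§2 / I.§1 for `A = ℝ, ℂ`). [folklore] -/
theorem IsStarFormallyReal.trace_mul_star_self_pos (hA : IsStarFormallyReal A) {a : A} (ha : a ≠ 0) :
    0 < Algebra.trace ℝ A (a * star a) := by
  classical
  set b : A := a * star a with hb
  have hb0 : b ≠ 0 := by
    intro h0
    have h1 : star (star a) * star a = 0 := by rw [star_star]; exact h0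
    have h2 := hA 1 (fun _ ↦ star a) (by rw [Fin.sum_univ_one]; exact h1) 0
    exact ha (by simpa using congrArg star h2)
  obtain ⟨s, hs0, hprod⟩ := hA.exists_finset_prod_eq_zero a
  rw [← hb] at hprod
  have hsne : s.Nonempty := by
    rw [Finset.nonempty_iff_ne_empty]
    rintro rfl
    rw [Finset.prod_empty] at hprod
    exact hb0 (by rw [← one_mul b, hprod, zero_mul])
  -- the Lagrange idempotents
  set e : ℝ → A := fun r ↦ aeval b (Lagrange.basis s id r) with he
  have hinj : Set.InjOn (id : ℝ → ℝ) (s : Set ℝ) := Set.injOn_id _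
  -- (L1) `∑ e_r = 1`
  have hL1 : ∑ r ∈ s, e r = 1 := by
    have := congrArg (aeval b) (Lagrange.sum_basis hinj hsne)
    rwa [map_sum, map_one] at this
  -- (L2) `(b - r) e_r = 0`
  have hnodal : aeval b (Lagrange.nodal s id) = 0 := by
    rw [Lagrange.nodal, map_prod]
    simp only [map_sub, aeval_X, aeval_C, id]
    exact hprod
  have hL2 : ∀ r ∈ s, (b - algebraMap ℝ A r) * e r = 0 := by
    intro r hr
    have hfac : (X - C r) * Lagrange.basis s id r =
        C (∏ j ∈ s.erase r, ((r : ℝ) - j)⁻¹) * Lagrange.nodal s id := by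
      rw [Lagrange.basis]
      simp only [Lagrange.basisDivisor, id]
      rw [Finset.prod_mul_distrib, ← map_prod C, mul_left_comm, Lagrange.nodal,
        Finset.mul_prod_erase s (fun j ↦ X - C j) hr]
      rfl
    have := congrArg (aeval b) hfac
    rw [map_mul, map_sub, aeval_X, aeval_C, map_mul, hnodal, mul_zero] at this
    exact this
  -- (L3) `e_r e_{r'} = 0` for `r ≠ r'`
  have hL3 : ∀ r ∈ s, ∀ r' ∈ s, r ≠ r' → e r * e r' = 0 := by
    intro r hr r' hr' hne
    have hr_mem : r ∈ s.erase r' := Finset.mem_erase.2 ⟨hne, hr⟩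
    have hsplit : Lagrange.basis s id r' = Lagrange.basisDivisor (id r' : ℝ) (id r) *
        ∏ j ∈ (s.erase r').erase r, Lagrange.basisDivisor (id r' : ℝ) (id j) := by
      rw [Lagrange.basis, ← Finset.mul_prod_erase _ _ hr_mem]
    have h2 := hL2 r hr
    change aeval b (Lagrange.basis s id r) * aeval b (Lagrange.basis s id r') = 0
    rw [hsplit, map_mul, Lagrange.basisDivisor, map_mul, aeval_C, map_sub, aeval_X, aeval_C]
    simp only [id]
    calc aeval b (Lagrange.basis s id r) *
          (algebraMap ℝ A (r' - r)⁻¹ * (b - algebraMap ℝ A r) *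
            aeval b (∏ j ∈ (s.erase r').erase r, Lagrange.basisDivisor r' j))
        = algebraMap ℝ A (r' - r)⁻¹ * ((b - algebraMap ℝ A r) * aeval b (Lagrange.basis s id r)) *
            aeval b (∏ j ∈ (s.erase r').erase r, Lagrange.basisDivisor r' j) := by ring
      _ = 0 := by
          rw [show aeval b (Lagrange.basis s id r) = e r from rfl, h2, mul_zero, zero_mul]
  -- (L4) `e_r² = e_r`
  have hL4 : ∀ r ∈ s, e r * e r = e r := by
    intro r hr
    have h1 : ∑ r' ∈ s, e r * e r' = e r * e r :=
      Finset.sum_eq_single_of_mem r hr fun r' hr' hne ↦ hL3 r hr r' hr' (Ne.symm hne)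
    rw [← h1, ← Finset.mul_sum, hL1, mul_one]
  -- (L5) `b = ∑ r e_r`
  have hL5 : b = ∑ r ∈ s, algebraMap ℝ A r * e r := by
    calc b = b * ∑ r ∈ s, e r := by rw [hL1, mul_one]
      _ = ∑ r ∈ s, b * e r := Finset.mul_sum _ _ _
      _ = ∑ r ∈ s, algebraMap ℝ A r * e r := by
          refine Finset.sum_congr rfl fun r hr ↦ ?_
          have := hL2 r hr
          rw [sub_mul, sub_eq_zero] at this
          exact this
  -- traces of the idempotents are dimensions
  have htr : ∀ r ∈ s, Algebra.trace ℝ A (e r) =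
      (Module.finrank ℝ (LinearMap.range (Algebra.lmul ℝ A (e r) : A →ₗ[ℝ] A)) : ℝ) := by
    intro r hr
    have hidem : IsIdempotentElem (Algebra.lmul ℝ A (e r) : A →ₗ[ℝ] A) := by
      rw [IsIdempotentElem, ← map_mul, hL4 r hr]
    rw [Algebra.trace_apply]
    exact (LinearMap.IsIdempotentElem.isProj_range _ hidem).trace
  have htb : Algebra.trace ℝ A b =
      ∑ r ∈ s, r * (Module.finrank ℝ (LinearMap.range (Algebra.lmul ℝ A (e r) : A →ₗ[ℝ] A)) : ℝ) := by
    conv_lhs => rw [hL5]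
    rw [map_sum]
    refine Finset.sum_congr rfl fun r hr ↦ ?_
    rw [Algebra.algebraMap_eq_smul_one, smul_mul_assoc, one_mul, map_smul, htr r hr, smul_eq_mul]
  -- some `r e_r ≠ 0`, with `r > 0` and `e_r ≠ 0`
  have hex : ∃ r ∈ s, algebraMap ℝ A r * e r ≠ 0 := by
    by_contra h
    push Not at h
    exact hb0 (by rw [hL5]; exact Finset.sum_eq_zero h)
  obtain ⟨r₀, hr₀, hne⟩ := hex
  have hr₀0 : r₀ ≠ 0 := by
    rintro rfl
    exact hne (by rw [map_zero, zero_mul])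
  have hr₀pos : 0 < r₀ := lt_of_le_of_ne (hs0 r₀ hr₀) (Ne.symm hr₀0)
  have he0 : e r₀ ≠ 0 := fun h0 ↦ hne (by rw [h0, mul_zero])
  have hrank : 1 ≤ Module.finrank ℝ (LinearMap.range (Algebra.lmul ℝ A (e r₀) : A →ₗ[ℝ] A)) := by
    have hmem : e r₀ ∈ LinearMap.range (Algebra.lmul ℝ A (e r₀) : A →ₗ[ℝ] A) :=
      ⟨1, by rw [lmul_apply', mul_one]⟩
    refine Nat.one_le_iff_ne_zero.2 fun h0 ↦ he0 ?_
    rw [Submodule.finrank_eq_zero] at h0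
    rw [h0] at hmem
    exact (Submodule.mem_bot ℝ).1 hmem
  rw [htb]
  calc (0 : ℝ) < r₀ * 1 := by rw [mul_one]; exact hr₀pos
    _ ≤ r₀ * (Module.finrank ℝ (LinearMap.range (Algebra.lmul ℝ A (e r₀) : A →ₗ[ℝ] A)) : ℝ) :=
        mul_le_mul_of_nonneg_left (by exact_mod_cast hrank) hr₀pos.le
    _ ≤ ∑ r ∈ s, r * (Module.finrank ℝ (LinearMap.range (Algebra.lmul ℝ A (e r) : A →ₗ[ℝ] A)) : ℝ) :=
        Finset.single_le_sum (f := fun r ↦ r *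
          (Module.finrank ℝ (LinearMap.range (Algebra.lmul ℝ A (e r) : A →ₗ[ℝ] A)) : ℝ))
          (fun r hr ↦ mul_nonneg (hs0 r hr) (Nat.cast_nonneg _)) hr₀

/-- `tr (a · star a) ≥ 0`. [folklore] -/
theorem IsStarFormallyReal.trace_mul_star_self_nonneg (hA : IsStarFormallyReal A) (a : A) :
    0 ≤ Algebra.trace ℝ A (a * star a) := by
  by_cases ha : a = 0
  · rw [ha, zero_mul, map_zero]
  · exact (hA.trace_mul_star_self_pos ha).le

/-- `tr (∑ᵢ aᵢ · star aᵢ) > 0` as soon as some `aᵢ ≠ 0`. [folklore] -/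
theorem IsStarFormallyReal.trace_sum_mul_star_self_pos (hA : IsStarFormallyReal A) {ι : Type*}
    (s : Finset ι) (f : ι → A) {i : ι} (hi : i ∈ s) (hfi : f i ≠ 0) :
    0 < Algebra.trace ℝ A (∑ j ∈ s, f j * star (f j)) := by
  rw [map_sum]
  refine lt_of_lt_of_le (hA.trace_mul_star_self_pos hfi) ?_
  exact Finset.single_le_sum (f := fun j ↦ Algebra.trace ℝ A (f j * star (f j)))
    (fun j _ ↦ hA.trace_mul_star_self_nonneg (f j)) hi

/-- `tr (star a · a) > 0` for `a ≠ 0` (the form consumed by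
`IsAutomorphicForm.exists_elliptic_annihilator`). [folklore] -/
theorem IsStarFormallyReal.algebraTrace_star_mul_self_pos (hA : IsStarFormallyReal A) {a : A}
    (ha : a ≠ 0) : 0 < Algebra.trace ℝ A (star a * a) := by
  rw [mul_comm]; exact hA.trace_mul_star_self_pos ha

/-- **A positive star-trace exists** on a finite-dimensional star-formally-real commutative real
`*`-algebra with `ℝ`-linear involution: the regular trace (`trace_star`,
`algebraTrace_star_mul_self_pos`), in the packaging consumed by
`IsAutomorphicForm.exists_elliptic_annihilator`. [folklore] -/
theorem IsStarFormallyReal.exists_positive_starTrace (hA : IsStarFormallyReal A) :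
    ∃ tr : A →ₗ[ℝ] ℝ, (∀ a, tr (star a) = tr a) ∧ ∀ a : A, a ≠ 0 → 0 < tr (star a * a) :=
  ⟨Algebra.trace ℝ A, trace_star, fun _ ha ↦ hA.algebraTrace_star_mul_self_pos ha⟩

end Trace

end Literature.NumberTheory.Automorphic
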